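import Mathlib
import HarnessLib
import HarnessLib.Audit
import Summits.CriticalPhenomena.Statement
import Summits.CriticalPhenomena.PercolationContinuityZ3.Theorems.PercPorousCriticalFiniteClusterVolumeTail

/-!
Route: PercFoamCut

# Route PercFoamCut — cutting a percolating cluster in half costs n^2 open edges, BGN lets the
critical foam leak only o(n^2)

It suffices to show X = MacroCutLog ∧ LogBGN (card
CriticalPhenomena/PercolationContinuityZ3/two-arm-foam-structure, corrected).
MacroCutLog (ANTI-FOAM): at every p with θ(p) > 0 and for every a > 0 there is c > 0 such that, with
probability → 1 as n → ∞, the trace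
C_∞ ∩ Λ_n of the infinite cluster admits no partition into two parts of ≥ a|Λ_n| vertices each
separated by ≤ c n²/log n open edges
(counting all open edges leaving the first part). LogBGN (LEAK RATE): at p_c(ℤ³) the half-space
one-arm probability
h(r) = P(0 ↔ sup-distance r inside {x₀ ≥ 0}) satisfies h(r)·log r → 0 — a logarithmic rate in
Barsky–Grimmett–Newman's θ_ℍ(p_c) = 0.
The card's foam picture is kept and its two halves are swapped in status: 'the jump world is a foam'
(W3) becomes a LEMMA provable now from
BGN (support JumpFoamCheapCut: the would-be critical cluster has balanced cuts of cost ≤ C n² h(n/4)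
= o(n²) at every scale — cells = deep
half-box clusters, walls = the sphere ∂Λ_{n/2} with o(n²) pinholes), and 'anti-foam' (W2) becomes
the crux MacroCutLog, stated in the only
currency that bites (open edges between two θ-dense cells; the card's 'non-C separating layers' are
satisfied by the foam and beaten by planes).
Lean: `(∀ p : unitInterval, 0 < Literature.Probability.Percolation.theta
(Literature.Probability.LatticeModels.zdGraph 3) 0 p → ∀ a : ℝ, 0 < a → ∃ c : ℝ, 0 < c ∧
Filter.Tendsto (fun n : ℕ => (Literature.Probability.Percolation.bondPercolation
(Literature.Probability.LatticeModels.zdGraph 3) p).real {ω | ∃ A : Finset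
(Literature.Probability.LatticeModels.Site 3), (∀ x ∈ A, x ∈
Literature.Probability.LatticeModels.box 3 n ∧ ω ∈ Literature.Probability.Percolation.percolatesAt
x) ∧ a * (2 * (n : ℝ) + 1) ^ 3 ≤ (A.card : ℝ) ∧ a * (2 * (n : ℝ) + 1) ^ 3 ≤
(((Literature.Probability.LatticeModels.box 3 n).filter (fun x => ω ∈
Literature.Probability.Percolation.percolatesAt x ∧ x ∉ A)).card : ℝ) ∧
(((Literature.Probability.LatticeModels.edgeBoundary (Literature.Probability.LatticeModels.zdGraph
3) A).filter (fun e => e ∈ ω)).card : ℝ) ≤ c * (n : ℝ) ^ 2 / Real.log (n : ℝ)}) Filter.atTop (nhds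
0)) ∧ (Filter.Tendsto (fun r : ℕ => Real.log (r : ℝ) *
(Literature.Probability.Percolation.bondPercolation (Literature.Probability.LatticeModels.zdGraph 3)
(Literature.Probability.Percolation.criticalProbI 3)).real {ω | ∃ y :
Literature.Probability.LatticeModels.Site 3, (∃ i : Fin 3, ((r : ℕ) : ℤ) ≤ |y i|) ∧ ω ∈
Literature.Probability.Percolation.openConnIn {x : Literature.Probability.LatticeModels.Site 3 | 0 ≤
x 0} 0 y}) Filter.atTop (nhds 0))`

## Assembly
Pure bookkeeping once the support JumpFoamCheapCut is proved (BGN in tree + Harris + first moment +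
lattice symmetry): a jump θ(p_c) = θ* > 0 makes
the cheap-cut event at p_c have probability ≥ θ*²/4 − (leak bound)/(cut budget) for all large n,
while MacroCutLog says it tends to 0; with budget
c n²/log n the leak term is ≤ (8/c)·h(n/4)·log n → 0 by LogBGN. Standard reductions used: none
beyond Markov, Harris–FKG, continuity of measure.

Rationale: WHY THIS LINE. Mechanism: Barsky–Grimmett–Newman (BarskyGrimmettNewman1991 = Grimmett1999 Thm
(7.35), PROVED in the tree as BarskyGrimmettNewman1991_Z3_holds)
is the one sprinkle-free supercritical theorem, and pointed at a box instead of a plane it says that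
a would-be critical infinite cluster leaks
out of the inner half-box Λ_{n/2} through only 6(n+1)²·h(n/4) = o(n²) open edges while filling both
Λ_{n/4} and the shell Λ_n∖Λ_{n/2} with density
θ(p_c)/2 (first moment + Harris): the impossible cluster IS a foam with o(n²) pinholes per cell wall
(Zhang2000 / RossignolTheret2018 Prop 3.9 use
the same cutset on the bottom face to get the flow constant ν(p_c) = 0; CerfDembin2020 =
arXiv:1903.08065 Thm 1.2 get anchored cheap sets of
uncontrolled volume; the BALANCE of both sides is what is new and what a cut crux can bite on). The
anti-foam side is imported from the
isoperimetry / heat-kernel theory of supercritical clusters (doi:10.1007/s00440-002-0246-y,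
doi:10.1214/aop/1078415830, doi:10.1214/07-aihp126,
Pete2008, arXiv:1602.05598, Dembin arXiv:1810.11239): balanced cuts of C_p ∩ Λ_n cost ≥ c n² for
every p > p_c, and Hutchcroft's p-blind union
bound (arXiv:2207.05226 Remark 1.2) derives the log-weakened form from the Kesten–Zhang tail at the
SAME p — so the route's second contribution is
an assembly joining two cruxes already on the books: PercDebrisSweep's K (FiniteClusterVolumeTail)
and PercLowPointHalfSpace's C (QuantitativeBGN)
imply θ(p_c) = 0 together (K ∧ LogBGN suffices), removing DebrisSweep's technology-free subcritical
exponent γ₀ < 3 and LowPoint's exponent cruxes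
A, B from that closing. What was dropped from the card and why: the exits identity F1 is not needed
(edges with labels in (p_c−ε, p_c] have density
exactly 3ε) and the two-arm sparsity F2 (AizenmanKestenNewmanCMP1987, Cerf2015) cannot see membranes
— with the AKN rate log n/√n every
counting form of 'cells behind non-C walls' is also satisfied by a box partition of a genuinely
supercritical cluster, and every repair funnels
into the dichotomy pieces ≶ ε⁻³ of card isoperimetry-plus-gamma-lt-3; BGN's half-space sparsity is
the contact-sparsity statement that is both
proved and sharp enough. Versus routes: PercHalfSpace/PercOpenSupercrit ask same-p
percolation/criteria, PercFiniteBoxLRO linear LRO (connection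
probabilities, which do not control cuts), PercDebrisSweep K + γ₀ < 3, zero-flux card face-to-face
flux ≥ g(density); none uses balanced
internal cuts, and none has a jump-world lemma proved outright. Negatives index: only stmt-0772
(SAW), unrelated.

RANKED CRUXES. #2 MacroCutLog (crux) — ANTI-FOAM, the card's W2 in the one currency that bites (open
edges between two theta-dense cells): for every p with theta(p) > 0 and every a > 0 there is c > 0
such that P_p(the trace C_inf ∩ Λ_n of the infinite cluster splits into a part A and its complement,
both with >= a|Λ_n| vertices, with at most c n^2/log n open edges leaving A) -> 0 as n -> oo (Λ_n =
box 3 n; all open edges with exactly one endpoint in A are counted, wherever they go). True for p >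
p_c (Kesten-Zhang + the p-blind support KGivesMacroCutLog; exact order n^2 by
Mathieu-Remy/BBHK/Pete2008); the content is the hypothetical percolating p = p_c, where it must be
proved without knowing p > p_c. [difficulty: open-problem] (why it might fail: False iff
theta(p_c)>0 (then JumpFoamCheapCut gives o(n^2) balanced cuts), so only a p-blind proof can work,
and every proof of cluster isoperimetry (Mathieu-Remy, BBHK, Pete2008, Gold, DERST 2026 Prop 2.1)
sprinkles through theta(p-eta)>0 or Grimmett-Marstrand.) [Pete2008, doi:10.1214/aop/1078415830,
doi:10.1214/07-aihp126, doi:10.1007/s00440-002-0246-y, arXiv:2207.05226, arXiv:2603.03257,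
arXiv:1602.05598]
#3 LogBGN (crux) — A LOGARITHMIC RATE FOR BARSKY-GRIMMETT-NEWMAN: at p_c(Z^3), h(r) := P(0 is joined
inside the half-space {x_0 >= 0} to a site at sup-distance >= r) satisfies h(r) log r -> 0 (same
event as PercLowPointHalfSpace.QuantitativeBGN, which gives h <= C r^-a and hence this). BGN itself
(h -> 0) is proved in the tree (BarskyGrimmettNewman1991_Z3_holds); predicted h(r) ~ r^-0.975. This
is the leak rate of the foam cells in JumpFoamCheapCut. [difficulty: L] (why it might fail: BGN
(Grimmett1999 Thm 7.35) is proved by contradiction via a finite-size criterion and gives no rate at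
all (KozmaNitzan2024 p.2 item 4); a jump world may have arbitrarily slow half-space decay; even
1/log r needs a quantitative steering/renewal scheme nobody has.) [BarskyGrimmettNewman1991,
Grimmett1999, KozmaNitzan2024, doi:10.1103/PhysRevE.71.016117]
#4 FiniteClusterVolumeTail (crux) — KESTEN-ZHANG AT THE SAME p (shared verbatim with route
PercDebrisSweep, item K): for every p with theta(p) > 0 there is c > 0 with P_p(m <= |C(0)| < oo) <=
exp(-c m^{2/3}) for all m >= 1. A THEOREM for p > p_c (doi:10.1214/aop/1176990844 = Grimmett1999 Thm
(8.65)); here it is the ENGINE of MacroCutLog: the p-blind union bound of arXiv:2207.05226 (Remark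
1.2) turns it into in-box isoperimetry of C_p with a log loss (support KGivesMacroCutLog), so
FiniteClusterVolumeTail ∧ LogBGN => PercolationContinuityZ3 - this route makes DebrisSweep's K and
LowPointHalfSpace's C close the conjunct together, without DebrisSweep's subcritical exponent crux
gamma_0 < 3. [difficulty: open-problem] (why it might fail: Theorem only for p>p_c (Kesten-Zhang via
Grimmett-Marstrand); at a percolating p_c it is conjunct-adjacent: by arXiv:2207.05226 Thm 1.1 it is
equivalent up to epsilon to anchored 3-isoperimetry of C_p, which arXiv:1903.08065 Thm 1.2 breaks
along a subsequence if theta(p_c)>0.) [doi:10.1214/aop/1176990844, Grimmett1999, arXiv:2207.05226,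
arXiv:1903.08065, Pete2008]
#5 QuantitativeBGN (crux) — ANY POWER RATE FOR BGN (shared verbatim with route
PercLowPointHalfSpace, item C = stmt-CriticalPhenomena-0913): at p_c(Z^3), P(C_H(0) reaches
sup-distance >= r) <= C r^-a for some a > 0. Implies LogBGN at once; with it the cut crux can even
be weakened to 'balanced cuts cost >= n^b' for any b > 2 - a/2 (see Two-layer plan). Wanted here to
record the cross-route demand. [difficulty: L] (why it might fail: As stmt-0913: BGN is qualitative
({theta_H>0} open via a finite-size criterion), no rate in print for d=3; a power law needs a
scale-uniform half-space shell-crossing bound, an RSW-type input unknown in 3D; numerically a = x_s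
~ 0.975 leaves room but no tool.) [BarskyGrimmettNewman1991, Grimmett1999, KozmaNitzan2024,
doi:10.1103/PhysRevE.71.016117, arXiv:1810.03750]
#6 MacroCutQuadratic (crux) — THE RATE-FREE CLOSING: as MacroCutLog with budget c n^2 (exact surface
order): theta(p) > 0 => P_p(some balanced part of C_inf ∩ Λ_n has <= c n^2 open edges leaving it) ->
0. For p > p_c this is the in-box isoperimetric inequality of the supercritical cluster
(doi:10.1214/aop/1078415830, doi:10.1214/07-aihp126, Pete2008 - exact exponent (d-1)/d via
Grimmett-Marstrand coarse graining). It closes the conjunct ALONE with plain BGN (support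
QuadraticCutAssembly) and rests only on facts PROVED in the tree. [difficulty: open-problem] (why it
might fail: Same-p like MacroCutLog but with no slack: even granted FiniteClusterVolumeTail the
p-blind union bound loses log n (arXiv:2207.05226 Rem 1.2), so exact surface order at a percolating
p_c needs GM-free coarse graining: SprinklingRenormalisation head-on.) [doi:10.1214/aop/1078415830,
doi:10.1214/07-aihp126, Pete2008, arXiv:1602.05598, arXiv:1110.6006, Grimmett1999]
#9 JumpFoamCheapCut (support) — THE FOAM IS REAL (the card's W3 made a lemma; valid in every world,
informative iff theta(p_c) > 0; provable now): for n >= 4 and t > 0, with m = n/2 (integer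
division), P_{p_c}(exists A ⊆ C_inf ∩ Λ_n with |A| >= (theta(p_c)/2)|Λ_{n/4}|, |C_inf ∩ Λ_n minus A|
>= (theta(p_c)/2)(|Λ_n| - |Λ_m|) and at most t open edges leaving A) >= theta(p_c)^2/4 - 6(2m+1)^2
h(n/4)/t, h as in LogBGN. PROOF: A := {x in C_inf ∩ Λ_m : x <-> Λ_{n/4} inside Λ_m}. An open edge
leaving A cannot end in Λ_m (its endpoint would be in A), so it exits Λ_m at a face site whose
Λ_m-cluster reaches Λ_{n/4}, i.e. a half-space arm of sup-length >= m - m/2 >= n/4 rooted on that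
face; by lattice symmetry (LatticeSymmetry.lean / BondPercolationSymmetry.lean) each of the
6(2m+1)^2 (face, site) pairs has arm probability <= h(n/4), so E(#open edges leaving A) <= 6(2m+1)^2
h(n/4) and Markov bounds the leak. Volumes: |A| >= |C_inf ∩ Λ_{n/4}| and |C_inf ∩ Λ_n minus A| >=
|C_inf ∩ (Λ_n minus Λ_m)|; the events {|C_inf ∩ D| >= theta|D|/2} for D = Λ_{n/4} and D = Λ_n minus
Λ_m are increasing, each of probability >= theta/2 (E|C_inf ∩ D| = theta|D| and |C_inf ∩ D| <= |D|),
jointly >= theta^2/4 by Harris (HarrisInequality.lean). With h -> 0 (BGN) these are o(n^2) BALANCED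
cuts of the would-be critical cluster at EVERY scale: Zhang's zero-flux cutset (Zhang2000;
RossignolTheret2018 Prop 3.9) moved from the bottom face to the half-box, the balance being what the
cruxes need. Dossier fact for cards critical-cluster-threshold-one, zero-flux-last-order-parameter,
isoperimetry-plus-gamma-lt-3. [difficulty: provable-now] [BarskyGrimmettNewman1991, Zhang2000,
RossignolTheret2018, arXiv:1903.08065, Grimmett1999]
#9 KGivesMacroCutLog (support) — FiniteClusterVolumeTail -> MacroCutLog, p-blind (provable now, ~400
Lean lines over ClusterBoundary.lean): (i) union bound as in arXiv:2207.05226 Remark 1.2 / proof of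
(iii)=>(iv): if S ∋ v is open-connected with j <= b open boundary edges, closing them makes S the
(finite) cluster of v; the map is at most (b+1) C(6|S|, b)-to-one with weight ratio (p/(1-p))^j, so
with b = kappa |S|^{2/3}/log|S|, kappa < c/4, P(exists such S ∋ v with |S| = t) <= exp(-(c/2)
t^{2/3}); union over v in Λ_n and t >= (C log n)^{3/2}: w.h.p. every open-connected S meeting Λ_n
with |S| >= (C log n)^{3/2} has more than kappa |S|^{2/3}/log|S| open boundary edges. (ii)
components: if A is a balanced part with F = open edges leaving A, the open-components J_i of A
satisfy sum |bd J_i| = |F| and |bd J_i| >= 1 (J_i is a finite proper subset of the infinite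
connected C_inf), so small components carry volume <= |F| (C log n)^{3/2} = o(n^3) and the big ones
force |F| >= kappa (a|Λ_n| - o(n^3)) / ((6n+3) log(27 n^3)) >= c' n^2/log n. (p = 1 is settled by
the isoperimetric inequality of Z^3 directly.) [difficulty: provable-now] [arXiv:2207.05226,
Pete2008, doi:10.1214/07-aihp126]
#9 QuadraticCutAssembly (support) — MacroCutQuadratic -> PercolationContinuityZ3 (the rate-free
closing; provable now given JumpFoamCheapCut): if theta(p_c) = theta* > 0, MacroCutQuadratic at p =
p_c with a = theta*/250 gives c with P(cheap balanced cut) -> 0, while JumpFoamCheapCut with t = c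
n^2 gives probability >= theta*^2/4 - 6(n+1)^2 h(n/4)/(c n^2) -> theta*^2/4 > 0, because h(r) -> 0
by BGN (continuity from above: the intersection over r of the arm events is {C_H(0) infinite}, null
by BarskyGrimmettNewman1991_Z3_holds). Thresholds match: (theta*/2)|Λ_{n/4}| >= (theta*/250)|Λ_n|
and (theta*/2)(|Λ_n| - |Λ_{n/2}|) >= (theta*/250)|Λ_n| for n large. [difficulty: provable-now]
[BarskyGrimmettNewman1991, Grimmett1999, Zhang2000]

TWO-LAYER PLAN. Foreseen glued splits (nothing filed now; k ≤ 3, depth 1): MacroCutQuadratic ⇐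
BlockUniquenessSameP → CoarsePeierls → MacroCutQuadratic
(same-p block event 'unique crossing cluster of Λ_{3L} among clusters of diameter ≥ L/10' with
probability → 1 whenever θ(p) > 0, then
Liggett–Schonmann–Stacey + Peierls over coarse surfaces, the BBHK/Pete proof with its one sprinkled
input isolated); LogBGN ⇐ HalfSpaceShellBound →
RenewalAcrossScales → LogBGN (a scale-uniform bound < 1 on crossing a half-space shell at p_c, then
independence of disjoint shells); and, once
QuantitativeBGN (rate a) lands, the sibling closing PowerCut(b) ∧ QuantitativeBGN with b > 2 − a/2
('balanced cuts cost ≥ n^b'), a separate route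
sharing decls rather than a rival family here.

KILL CRITERIA. MacroCutLog, MacroCutQuadratic and FiniteClusterVolumeTail are theorems for p > p_c,
so a refutation can only live at p = p_c and would itself be
θ(p_c) > 0 — close `refuted:<Decl>` and the conjunct is dead for every route. LogBGN refuted
(h(r)·log r ↛ 0 at p_c, a 'slow BGN' theorem) kills
the main Assembly and QuantitativeBGN (hence PercLowPointHalfSpace's crux C) at once: pivot to the
rate-free closing QuadraticCutAssembly, i.e.
restate the route as X = MacroCutQuadratic (conditional-bridge shape, one crux). A refuter showing
that KGivesMacroCutLog's union bound cannot be
made p-blind (it can: finite energy + counting only) would downgrade FiniteClusterVolumeTail to 'not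
an engine' — drop it. Mooted if PercDebrisSweep
(K ∧ γ₀ < 3) or PercLowPointHalfSpace closes first; JumpFoamCheapCut stays useful as a dossier
theorem either way.

NOT DECOMPOSED YET. The lattice-symmetry lemma (arm probabilities rooted on any face of any box
equal h), the p = 1 edge case of KGivesMacroCutLog, measurability of
the cut events, and the choice of constants (a = θ*/250, t = c n²/log n) are prover-level. No
ergodic theorem is needed (first moment + Harris give
probability θ*²/4, enough against '→ 0'). Deliberately NOT filed: a uniform-in-density finite-n form
'for all a there are c, N such that for ALL p
and n ≥ N, P_p(a-balanced cut of cost ≤ c n²) ≤ 1/2' (the zero-flux card's packaging; it bites only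
where θ(p) ≥ a and is what a p-blind proof would
give anyway); the block-uniqueness engine (overlaps PercOpenSupercrit r2 /
dense-piece-uniqueness-hub in spirit); the card's F1/F2 as support
items (true, cheap, not load-bearing: exits have density 3ε; closed contacts between two large
(p_c−ε)-pieces are two-arm edges, AKN/Cerf2015).

CHEAPEST FALSIFIER. (1) Ten-line check of the glue, done on paper here and worth a refuter's second
pair of eyes: every open edge leaving A = {x ∈ C_∞ ∩ Λ_m : x ↔ Λ_{m/2}
inside Λ_m} exits Λ_m at a face site carrying a half-space arm of length ≥ m/2 (injective edge ↦
(site, face)), and the two density events are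
increasing with probability ≥ θ/2 each. (2) Lookup: is 'Kesten–Zhang tail at the same p + any BGN
rate ⇒ θ(p_c) = 0' already remarked in
arXiv:2207.05226, arXiv:1903.08065, arXiv:2603.03257 or Zhang2000? Not in the pages read (listed
under Novelty). (3) Numerics (not run; kit
optional): max-flow between C ∩ Λ_{n/4} and C ∩ (Λ_n∖Λ_{n/2}) for bond percolation at p = 0.2488 vs
p = 0.27, n = 16…64: flux/n² should decay like
n^{-0.98} at p_c (the BGN leak with a = x_s) and stabilise at a positive constant above p_c; a
flux/n² decaying SLOWER than 1/log n at p_c would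
make LogBGN implausible.

NUMBERS. p_c(ℤ³, bond) ≈ 0.2488; boundary (half-space) one-arm exponent ≈ x_s ≈ 0.975
(doi:10.1103/PhysRevE.71.016117), so LogBGN and QuantitativeBGN hold
numerically with a wide margin; Kesten–Zhang exponent (d−1)/d = 2/3 exact for p > p_c (Grimmett1999
Thm (8.65), doi:10.1214/aop/1176990844);
balanced-cut cost of C_p ∩ Λ_n for p > p_c is ≍ n² (isoperimetric profile, Pete2008; Cheeger
constant ≍ 1/n, doi:10.1007/s00440-002-0246-y,
arXiv:1110.6006); jump-world leak ≤ 6(n+1)² h(n/4). Items at open: 9 (5 cruxes, of which 2 shared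
verbatim with PercDebrisSweep / PercLowPointHalfSpace;
3 supports; 1 assembly).

DEFINITION REQUESTS. None: box, edgeBoundary, percolatesAt, openConnIn, openCluster, theta,
criticalProbI, bondPercolation all exist (lean search --decl checked; Sketch.lean
rc 0). Cite fact wanted (filed after open as a cite item): Pete2008 Thm 1.1–1.2 /
doi:10.1214/07-aihp126 §5 — for p > p_c(ℤ^d) the infinite cluster
satisfies the in-box isoperimetric inequality |∂_C S| ≥ c|S|^{(d−1)/d} for connected S ⊆ C ∩ Λ_n,
|S| ≥ (log n)^{d/(d−1)}·C, w.h.p. — which discharges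
MacroCutQuadratic for p > p_c.

Novelty: Searches (2026-08-15): `lit search --source s2 "isoperimetric profile supercritical percolation
cluster"` (15: arXiv:1901.00367, arXiv:1810.11239,
Pete2008 = arXiv:math/0702474, arXiv:2207.05226, arXiv:1110.6006, arXiv:2603.03257,
arXiv:1903.08065, arXiv:1602.05598, arXiv:2309.14882 …);
`lit search --source s2 "Mathieu Remy isoperimetry heat kernel percolation"`
(doi:10.1214/aop/1078415830); `lit search --source crossref` for BBHK
(doi:10.1214/07-aihp126) and Benjamini–Mossel (doi:10.1007/s00440-002-0246-y); `lit read` of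
arXiv:2009.13337 pp.1–5, arXiv:2401.12397 pp.1–3 and
36–38 (approach (5), ref [8] van Engelenburg MSc 2020 §4.3), arXiv:1306.3105 pp.1–16 (Thm 1.3 proof:
n^{3d−1}·two-arms), arXiv:1903.08065 pp.1–5
(Thm 1.2 and its BGN exploration), arXiv:2603.03257 pp.1–9 (2026 supercritical sharpness; Prop 2.1
is sprinkled, q > p), arXiv:2207.05226 pp.1–4
(Thm 1.1, Remark 1.2); `lit galaxy search "two-arms probability" --star all` (rc 3, daemons queued
out); OpenAlex 429 (budget); the nine route files
and the cards announced-jump-dense-foam, critical-cluster-threshold-one,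
isoperimetry-plus-gamma-lt-3, dense-piece-uniqueness-hub,
zero-flux-last-order-parameter, counterfactual-cluster-resistance, plane-cut-two-partitions,
hollow-cells-inbox-shattering, halfspace-box-trace-facts,
chebyshev-variance-sandwich; `ledger negatives --problem CriticalPhenomena` (1 item, SAW).
Nearest prior art found: CerfDembin2020 = arXiv:1903.08065 Thm 1.2 (liminf n·φ̂_n(p_c) = 0: cheap
ANCHORED  [refs: 10.1214/aop/1078415830, 10.1214/07-aihp126, 10.1007/s00440-002-0246-y, 1901.00367, 1810.11239, math/0702474, 2207.05226, 1110.6006, 2603.03257, 1903.08065, 1602.05598, 2309.14882, 2009.13337, 2401.12397, 1306.3105, doi:10.1214/aop/1078415830, doi:10.1214/07-aihp126, doi:10.1007/s00440-002-0246-y, Pete2008, CerfDembin2020, Zhang2000, RossignolTheret2018]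

Barriers (technique_class: same-p cluster isoperimetry, BGN half-space leak counting): - technique_class: same-p cluster isoperimetry, BGN half-space leak counting
- Literature.Barriers.CriticalPhenomena.SprinklingRenormalisation: it does not evade it for
MacroCutLog / MacroCutQuadratic / FiniteClusterVolumeTail — each is a same-p supercritical statement
whose every known proof spends η > 0 (GM) or sprinkles (arXiv:2603.03257 Prop 2.1, q > p); the bet:
(i) balanced cuts with BOTH sides dense are the weakest same-p demand that still closes, (ii) the
jump-world half is discharged by the one sprinkle-free theorem (BGN, 'no extra money in the
half-space'), and (iii) LogBGN / QuantitativeBGN live entirely in the half-space where BGN's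
steering works at η = 0.
- Literature.Barriers.CriticalPhenomena.SlabLimitUniformControl: not engaged directly (no slab limit
is taken); but FiniteClusterVolumeTail at p_c is of the 'uniform control near p_c' difficulty DST
describe, declared in its why-line.
- Literature.Barriers.CriticalPhenomena.LongRangeDiscontinuity: evaded by finite range + d = 3
surface order: the contradiction is 'leak o(n²) through a sphere' against 'balanced cuts ≥ n²/log
n'; on ℤ with 1/r² bonds balanced cuts of [−n, n] cost O(log n) and there is no half-space theorem,
so the Aizenman–Newman jump is consistent with everything here, as it must be.
- Literature.Barriers.CriticalPhenomena.RandomClusterFirstOrder: evaded through BGN, a q = 1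
theorem: for wired q > Q(3) the critical FK cluster is dense AND has surface-order cuts, and the
half-space DOES percolate

Novelty grade: new-combination — refuter route-review grade (2026-08-15; search basis = planner's documented reads of arXiv:2207.05226/1903.08065/2603.03257 + my zbMATH/local-hybrid queries; S2/arXiv/galaxy legs were DOWN (429/rc75) during this session, so the grade rests mainly on the planner's search, and says so). Two known idea (refuter refuter-rreview-route-CriticalPhenomena--c23efa21-0, 2026-08-15T14:02:06Z; prior: Zhang2000; RossignolTheret2018 Prop 3.9; arXiv:1903.08065 Thm 1.2 (CerfDembin2020); Pete2008 (arXiv:math/0702474); arXiv:2207.05226 Rem 1.2; doi:10.1214/aop/1176990844 (Kesten-Zhang); BarskyGrimmettNewman1991)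

sub-problem: PercolationContinuityZ3 · status: open · opened planner-plancard-CriticalPhenomena-Percolatio-0933523f-0 2026-08-15T11:40:49Z · rev 3 · ledger route-CriticalPhenomena-PercFoamCut
GENERATED by the gate from the ledger (D-0016/17). Provers cite these decls: `theorem foo : Summit.CriticalPhenomena.PercolationContinuityZ3.Theses.PercFoamCut.<Decl> := …` in Summits/CriticalPhenomena/PercolationContinuityZ3/Theorems/<Name>.lean.
-/

namespace Summit.CriticalPhenomena.PercolationContinuityZ3.Theses.PercFoamCut

open scoped BigOperators Topology Manifold Classical MeasureTheory ProbabilityTheory Matrix InnerProductSpace ComplexConjugate ContinuousMap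
open Filter Set Function TopologicalSpace MeasureTheory

attribute [summit_statement] _root_.PercolationContinuityZ3

/-- item stmt-CriticalPhenomena-5333 · crux · rank 2 · closed · proved by Summit.CriticalPhenomena.PercolationContinuityZ3.Theorems.FoamCutMacroCutLog.macroCutLog_proof @ 2d0c226ac4fe (prover) · by planner
why it might fail: Theorem for p>p_c (KestenZhang1990 + p-blind union bound, arXiv:2207.05226 Rem 1.2), but given LogBGN FALSE at a percolating p_c (JumpFoamCheapCut: balanced cuts cost O(n^2 h(n/4))): needs p-blind cluster isoperimetry; every printed proof (Mathieu-Remy, BBHK, Pete2008, DERST2026) uses GM/sprinkling.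
sources: Pete2008, KestenZhang1990, GrimmettMarstrand1990, arXiv:2207.05226, doi:10.1214/aop/1078415830, doi:10.1214/07-aihp126
[crux] ANTI-FOAM, the card's W2 in the one currency that bites (open edges between two theta-dense
cells): for every p with theta(p) > 0 and every a > 0 there is c > 0 such that P_p(the trace C_inf ∩
Λ_n of the infinite cluster splits into a part A and its complement, both with >= a|Λ_n| vertices,
with at most c n^2/log n open edges leaving A) -> 0 as n -> oo (Λ_n = box 3 n; all open edges with
exactly one endpoint in A are counted, wherever they go). True for p > p_c (Kesten-Zhang + the
p-blind support KGivesMacroCutLog; exact order n^2 by Mathieu-Remy/BBHK/Pete2008); the content is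
the hypothetical percolating p = p_c, where it must be proved without knowing p > p_c. [difficulty:
open-problem] -/
@[route_item "route-CriticalPhenomena-PercFoamCut"]
def MacroCutLog : Prop :=
  ∀ p : unitInterval, 0 < Literature.Probability.Percolation.theta (Literature.Probability.LatticeModels.zdGraph 3) 0 p → ∀ a : ℝ, 0 < a → ∃ c : ℝ, 0 < c ∧ Filter.Tendsto (fun n : ℕ => (Literature.Probability.Percolation.bondPercolation (Literature.Probability.LatticeModels.zdGraph 3) p).real {ω | ∃ A : Finset (Literature.Probability.LatticeModels.Site 3), (∀ x ∈ A, x ∈ Literature.Probability.LatticeModels.box 3 n ∧ ω ∈ Literature.Probability.Percolation.percolatesAt x) ∧ a * (2 * (n : ℝ) + 1) ^ 3 ≤ (A.card : ℝ) ∧ a * (2 * (n : ℝ) + 1) ^ 3 ≤ (((Literature.Probability.LatticeModels.box 3 n).filter (fun x => ω ∈ Literature.Probability.Percolation.percolatesAt x ∧ x ∉ A)).card : ℝ) ∧ (((Literature.Probability.LatticeModels.edgeBoundary (Literature.Probability.LatticeModels.zdGraph 3) A).filter (fun e => e ∈ ω)).card : ℝ) ≤ c * (n : ℝ) ^ 2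 / Real.log (n : ℝ)}) Filter.atTop (nhds 0)

/-- item stmt-CriticalPhenomena-5334 · crux · rank 3 · open · by planner
why it might fail: BGN's theta_H(p_c)=0 (Grimmett1999 Thm (7.35), in tree) comes from openness of a half-space finite-size criterion (KozmaNitzan2024 p.2 item 1) and gives no rate; half-space rates exist only in high d (arXiv:1810.03750); even o(1/log r) in d=3 needs quantitative multi-scale steering at eta=0 (none).
sources: BarskyGrimmettNewman1991, Grimmett1999, KozmaNitzan2024, arXiv:1810.03750, doi:10.1103/PhysRevE.71.016117, arXiv:2512.13624
[crux] A LOGARITHMIC RATE FOR BARSKY-GRIMMETT-NEWMAN: at p_c(Z^3), h(r) := P(0 is joined inside the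
half-space {x_0 >= 0} to a site at sup-distance >= r) satisfies h(r) log r -> 0 (same event as
PercLowPointHalfSpace.QuantitativeBGN, which gives h <= C r^-a and hence this). BGN itself (h -> 0)
is proved in the tree (BarskyGrimmettNewman1991_Z3_holds); predicted h(r) ~ r^-0.975. This is the
leak rate of the foam cells in JumpFoamCheapCut. [difficulty: L] -/
@[route_item "route-CriticalPhenomena-PercFoamCut"]
def LogBGN : Prop :=
  Filter.Tendsto (fun r : ℕ => Real.log (r : ℝ) * (Literature.Probability.Percolation.bondPercolation (Literature.Probability.LatticeModels.zdGraph 3) (Literature.Probability.Percolation.criticalProbI 3)).real {ω | ∃ y : Literature.Probability.LatticeModels.Site 3, (∃ i : Fin 3, ((r : ℕ) : ℤ) ≤ |y i|) ∧ ω ∈ Literature.Probability.Percolation.openConnIn {x : Literature.Probability.LatticeModels.Site 3 | 0 ≤ x 0} 0 y}) Filter.atTop (nhds 0)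

/-- item stmt-CriticalPhenomena-0943 · banked · rank 4 · closed · proved by Summit.CriticalPhenomena.PercolationContinuityZ3.Theorems.PercPorousCriticalFiniteClusterVolumeTail.finiteClusterVolumeTail_proof @ 175ae9e337de (prover) · by planner
why it might fail: Known only for p>p_c (KestenZhang1990 = Grimmett1999 Thm (8.65), via GM; DERST2026 Thm 1 also p>p_c, sprinkled). At a percolating p_c it sits on a cliff: CerfDembin2020 Thm 1.2 kills anchored t^{2/3}-isoperimetry of C(0) for every constant, yet this tail forces it up to 1/log t (2207.05226 Rem 1.2).
sources: KestenZhang1990, Grimmett1999, GrimmettMarstrand1990, CerfDembin2020, arXiv:2207.05226, arXiv:2603.03257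
[crux] r3 (K): Kesten-Zhang surface-order law AT THE SAME p: for every p with theta(p) > 0 there is
c > 0 with P_p(m <= |C(0)| < oo) <= exp(-c m^{2/3}) for all m >= 1 (event written with (openCluster
ω 0).encard and .Finite). A THEOREM for p > p_c (KestenZhang1990 doi:10.1214/aop/1176990844 =
Grimmett1999 Thm (8.65) p.216; Cerf 2000 Wulff LDP), all via Grimmett-Marstrand; the only new
content is the hypothetical percolating p = p_c. Calibration: FALSE for Aizenman-Newman 1/r^2 chains
at their jump (power-law finite-cluster tails), TRUE in the ordered phase of random-cluster q > Q at
p_c(q). Shared in spirit with quarantine-fat-islands (KzSameP) and porous-core-deletion-critical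
(L_{2/3}); by Grimmett1999 Thm (8.61) at a percolating p_c (ADS, needs only theta > 0) the bound
would be tight-order. Sources: doi:10.1214/aop/1176990844; Grimmett1999 Thm (8.65),(8.61);
arXiv:1902.03207. -/
@[route_item "route-CriticalPhenomena-PercFoamCut"]
def FiniteClusterVolumeTail : Prop :=
  ∀ p : unitInterval, 0 < Literature.Probability.Percolation.theta (Literature.Probability.LatticeModels.zdGraph 3) 0 p → ∃ c : ℝ, 0 < c ∧ ∀ m : ℕ, 1 ≤ m → (Literature.Probability.Percolation.bondPercolation (Literature.Probability.LatticeModels.zdGraph 3) p).real {ω | (m : ℕ∞) ≤ (Literature.Probability.Percolation.openCluster ω 0).encard ∧ (Literature.Probability.Percolation.openCluster ω 0).Finite} ≤ Real.exp (-(c * (m : ℝ) ^ ((2 : ℝ) / 3)))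

/-- `FiniteClusterVolumeTail` holds: proved by `Summit.CriticalPhenomena.PercolationContinuityZ3.Theorems.PercPorousCriticalFiniteClusterVolumeTail.finiteClusterVolumeTail_proof` @ 175ae9e337de. -/
theorem FiniteClusterVolumeTail_holds : FiniteClusterVolumeTail := _root_.Summit.CriticalPhenomena.PercolationContinuityZ3.Theorems.PercPorousCriticalFiniteClusterVolumeTail.finiteClusterVolumeTail_proof

/-- item stmt-CriticalPhenomena-0913 · aside · rank 5 · open · by planner
why it might fail: BGN is qualitative ({theta_H>0} open via a finite-size criterion, Grimmett1999 Thm (7.35)); no half-space rate in print for d=3 (n^-3 only in high d, arXiv:1810.03750); a power a>0 needs a scale-uniform bound <1 on crossing half-space shells at p_c, an RSW-type input unknown in 3D (x_s~0.975).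
sources: BarskyGrimmettNewman1991, Grimmett1999, KozmaNitzan2024, arXiv:1810.03750, doi:10.1103/PhysRevE.71.016117, arXiv:2512.13624
[crux] r4 (C): quantitative Barsky-Grimmett-Newman. At p_c(Z^3) the boundary one-arm probability
P(C_H(0) reaches sup-distance >= r) <= C r^{-a} for SOME a > 0 (numerically a = x_s ~ 0.975,
Deng-Blote 2005). BGN's theta_H(p_c) = 0 (proved in tree: BarskyGrimmettNewman1991_Z3_holds) is
soft, by contradiction through a finite-size criterion; a rate needs a renewal/multi-scale version
of steering. Publishable alone; wanted in spirit by cards counterfactual-cluster-resistance,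
boundary-critical-squeeze, climb-ratio-receding-floor-v2, quarantine-fat-islands (which needs a >
4/5). Sources: Grimmett1999 Thm (7.35) pp.162-169; KozmaNitzan2024 p.2 item 4 (no rate for BGN in
print); doi:10.1103/PhysRevE.71.016117. -/
@[route_item "route-CriticalPhenomena-PercFoamCut"]
def QuantitativeBGN : Prop :=
  ∃ a C : ℝ, 0 < a ∧ ∀ r : ℕ, 1 ≤ r → (Literature.Probability.Percolation.bondPercolation (Literature.Probability.LatticeModels.zdGraph 3) (Literature.Probability.Percolation.criticalProbI 3)).real {ω | ∃ y : Literature.Probability.LatticeModels.Site 3, (∃ i : Fin 3, (r : ℤ) ≤ |y i|) ∧ ω ∈ Literature.Probability.Percolation.openConnIn {x : Literature.Probability.LatticeModels.Site 3 | 0 ≤ x 0} 0 y} ≤ C * (r : ℝ) ^ (-a)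

/-- item stmt-CriticalPhenomena-5335 · aside · rank 6 · open · by planner
why it might fail: MacroCutLog with zero slack: FALSE at a percolating p_c by plain BGN (JumpFoamCheapCut: balanced cuts of cost 6(n+1)^2 h(n/4)=o(n^2)), so conjunct-equivalent modulo Pete2008; even granted FiniteClusterVolumeTail the p-blind union bound loses log n (2207.05226 Rem 1.2): needs GM-free coarse graining.
sources: Pete2008, GrimmettMarstrand1990, doi:10.1214/aop/1078415830, doi:10.1214/07-aihp126, arXiv:2207.05226, arXiv:1110.6006
[crux] THE RATE-FREE CLOSING: as MacroCutLog with budget c n^2 (exact surface order): theta(p) > 0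
=> P_p(some balanced part of C_inf ∩ Λ_n has <= c n^2 open edges leaving it) -> 0. For p > p_c this
is the in-box isoperimetric inequality of the supercritical cluster (doi:10.1214/aop/1078415830,
doi:10.1214/07-aihp126, Pete2008 - exact exponent (d-1)/d via Grimmett-Marstrand coarse graining).
It closes the conjunct ALONE with plain BGN (support QuadraticCutAssembly) and rests only on facts
PROVED in the tree. [difficulty: open-problem] -/
@[route_item "route-CriticalPhenomena-PercFoamCut"]
def MacroCutQuadratic : Prop :=
  ∀ p : unitInterval, 0 < Literature.Probability.Percolation.theta (Literature.Probability.LatticeModels.zdGraph 3) 0 p → ∀ a : ℝ, 0 < a → ∃ c : ℝ, 0 < c ∧ Filter.Tendsto (fun n : ℕ => (Literature.Probability.Percolation.bondPercolation (Literature.Probability.LatticeModels.zdGraph 3) p).real {ω | ∃ A : Finset (Literature.Probability.LatticeModels.Site 3), (∀ x ∈ A, x ∈ Literature.Probability.LatticeModels.box 3 n ∧ ω ∈ Literature.Probability.Percolation.percolatesAt x) ∧ a * (2 * (n : ℝ) + 1) ^ 3 ≤ (A.card : ℝ) ∧ a * (2 * (n : ℝ) + 1) ^ 3 ≤ (((Literature.Probability.LatticeModels.box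 3 n).filter (fun x => ω ∈ Literature.Probability.Percolation.percolatesAt x ∧ x ∉ A)).card : ℝ) ∧ (((Literature.Probability.LatticeModels.edgeBoundary (Literature.Probability.LatticeModels.zdGraph 3) A).filter (fun e => e ∈ ω)).card : ℝ) ≤ c * (n : ℝ) ^ 2}) Filter.atTop (nhds 0)

/-- item stmt-CriticalPhenomena-5336 · support · rank 9 · closed · proved by Summit.CriticalPhenomena.PercolationContinuityZ3.Theorems.PercFoamCutJumpFoamCheapCut.jumpFoamCheapCut_proof @ 175ae9e337de (prover) · by planner
sources: BarskyGrimmettNewman1991, Zhang2000, RossignolTheret2018, arXiv:1903.08065, Grimmett1999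
[support] THE FOAM IS REAL (the card's W3 made a lemma; valid in every world, informative iff
theta(p_c) > 0; provable now): for n >= 4 and t > 0, with m = n/2 (integer division), P_{p_c}(exists
A ⊆ C_inf ∩ Λ_n with |A| >= (theta(p_c)/2)|Λ_{n/4}|, |C_inf ∩ Λ_n minus A| >= (theta(p_c)/2)(|Λ_n| -
|Λ_m|) and at most t open edges leaving A) >= theta(p_c)^2/4 - 6(2m+1)^2 h(n/4)/t, h as in LogBGN.
PROOF: A := {x in C_inf ∩ Λ_m : x <-> Λ_{n/4} inside Λ_m}. An open edge leaving A cannot end in Λ_m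
(its endpoint would be in A), so it exits Λ_m at a face site whose Λ_m-cluster reaches Λ_{n/4}, i.e.
a half-space arm of sup-length >= m - m/2 >= n/4 rooted on that face; by lattice symmetry
(LatticeSymmetry.lean / BondPercolationSymmetry.lean) each of the 6(2m+1)^2 (face, site) pairs has
arm probability <= h(n/4), so E(#open edges leaving A) <= 6(2m+1)^2 h(n/4) and Markov bounds the
leak. Volumes: |A| >= |C_inf ∩ Λ_{n/4}| and |C_inf ∩ Λ_n minus A| >= |C_inf ∩ (Λ_n minus Λ_m)|; the
events {|C_inf ∩ D| >= theta|D|/2} for D = Λ_{n/4} and D = Λ_n minus Λ_m are increasing, each of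
probability >= theta/2 (E|C_inf ∩ D| = theta|D| and |C_inf ∩ D| <= |D|), jointly >= theta^2/4 by
Harris (HarrisInequality -/
@[route_item "route-CriticalPhenomena-PercFoamCut"]
def JumpFoamCheapCut : Prop :=
  ∀ n : ℕ, 4 ≤ n → ∀ t : ℝ, 0 < t → (Literature.Probability.Percolation.theta (Literature.Probability.LatticeModels.zdGraph 3) 0 (Literature.Probability.Percolation.criticalProbI 3)) ^ 2 / 4 - 6 * (2 * ((n / 2 : ℕ) : ℝ) + 1) ^ 2 * (Literature.Probability.Percolation.bondPercolation (Literature.Probability.LatticeModels.zdGraph 3) (Literature.Probability.Percolation.criticalProbI 3)).real {ω | ∃ y : Literature.Probability.LatticeModels.Site 3, (∃ i : Fin 3, ((n / 4 : ℕ) : ℤ) ≤ |y i|) ∧ ω ∈ Literature.Probability.Percolation.openConnIn {x : Literature.Probability.LatticeModels.Site 3 | 0 ≤ x 0} 0 y} / t ≤ (Literature.Probability.Percolation.bondPercolation (Literature.Probability.LatticeModels.zdGraph 3) (Literature.Probability.Percolation.criticalProbI 3)).real {ω | ∃ A : Finset (Literature.Probability.LatticeModels.Site 3), (∀ x ∈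 A, x ∈ Literature.Probability.LatticeModels.box 3 n ∧ ω ∈ Literature.Probability.Percolation.percolatesAt x) ∧ Literature.Probability.Percolation.theta (Literature.Probability.LatticeModels.zdGraph 3) 0 (Literature.Probability.Percolation.criticalProbI 3) / 2 * ((Literature.Probability.LatticeModels.box 3 (n / 4)).card : ℝ) ≤ (A.card : ℝ) ∧ Literature.Probability.Percolation.theta (Literature.Probability.LatticeModels.zdGraph 3) 0 (Literature.Probability.Percolation.criticalProbI 3) / 2 * (((Literature.Probability.LatticeModels.box 3 n).card : ℝ) - ((Literature.Probability.LatticeModels.box 3 (n / 2)).card : ℝ)) ≤ (((Literature.Probability.LatticeModels.box 3 n).filter (fun x => ω ∈ Literature.Probability.Percolation.percolatesAt x ∧ x ∉ A)).card : ℝ) ∧ (((Literature.Probability.LatticeModels.edgeBoundary (Literature.Probability.LatticeModels.zdGraph 3) A).filter (fun e => e ∈ ω)).card : ℝ) ≤ t}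

/-- item stmt-CriticalPhenomena-5337 · support · rank 9 · closed · proved by Summit.CriticalPhenomena.PercolationContinuityZ3.Theorems.MacroCutLog.kGivesMacroCutLog_proof @ 9664c0797792 (prover) · by planner
sources: arXiv:2207.05226, Pete2008, doi:10.1214/07-aihp126
[support] FiniteClusterVolumeTail -> MacroCutLog, p-blind (provable now, ~400 Lean lines over
ClusterBoundary.lean): (i) union bound as in arXiv:2207.05226 Remark 1.2 / proof of (iii)=>(iv): if
S ∋ v is open-connected with j <= b open boundary edges, closing them makes S the (finite) cluster
of v; the map is at most (b+1) C(6|S|, b)-to-one with weight ratio (p/(1-p))^j, so with b = kappa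
|S|^{2/3}/log|S|, kappa < c/4, P(exists such S ∋ v with |S| = t) <= exp(-(c/2) t^{2/3}); union over
v in Λ_n and t >= (C log n)^{3/2}: w.h.p. every open-connected S meeting Λ_n with |S| >= (C log
n)^{3/2} has more than kappa |S|^{2/3}/log|S| open boundary edges. (ii) components: if A is a
balanced part with F = open edges leaving A, the open-components J_i of A satisfy sum |bd J_i| = |F|
and |bd J_i| >= 1 (J_i is a finite proper subset of the infinite connected C_inf), so small
components carry volume <= |F| (C log n)^{3/2} = o(n^3) and the big ones force |F| >= kappa (a|Λ_n|
- o(n^3)) / ((6n+3) log(27 n^3)) >= c' n^2/log n. (p = 1 is settled by the isoperimetric inequality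
of Z^3 directly.) [difficulty: provable-now] -/
@[route_item "route-CriticalPhenomena-PercFoamCut"]
def KGivesMacroCutLog : Prop :=
  (∀ p : unitInterval, 0 < Literature.Probability.Percolation.theta (Literature.Probability.LatticeModels.zdGraph 3) 0 p → ∃ c : ℝ, 0 < c ∧ ∀ m : ℕ, 1 ≤ m → (Literature.Probability.Percolation.bondPercolation (Literature.Probability.LatticeModels.zdGraph 3) p).real {ω | (m : ℕ∞) ≤ (Literature.Probability.Percolation.openCluster ω 0).encard ∧ (Literature.Probability.Percolation.openCluster ω 0).Finite} ≤ Real.exp (-(c * (m : ℝ) ^ ((2 : ℝ) / 3)))) → (∀ p : unitInterval, 0 < Literature.Probability.Percolation.theta (Literature.Probability.LatticeModels.zdGraph 3) 0 p → ∀ a : ℝ, 0 < a → ∃ c : ℝ, 0 < c ∧ Filter.Tendsto (fun n : ℕ => (Literature.Probability.Percolation.bondPercolation (Literature.Probability.LatticeModels.zdGraph 3) p).real {ω | ∃ A : Finset (Literature.Probability.LatticeModels.Site 3), (∀ x ∈ A, x ∈ Literature.Probability.LatticeModels.box 3 n ∧ ω ∈ Literature.Probability.Percolation.percolatesAt x)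 ∧ a * (2 * (n : ℝ) + 1) ^ 3 ≤ (A.card : ℝ) ∧ a * (2 * (n : ℝ) + 1) ^ 3 ≤ (((Literature.Probability.LatticeModels.box 3 n).filter (fun x => ω ∈ Literature.Probability.Percolation.percolatesAt x ∧ x ∉ A)).card : ℝ) ∧ (((Literature.Probability.LatticeModels.edgeBoundary (Literature.Probability.LatticeModels.zdGraph 3) A).filter (fun e => e ∈ ω)).card : ℝ) ≤ c * (n : ℝ) ^ 2 / Real.log (n : ℝ)}) Filter.atTop (nhds 0))

/-- item stmt-CriticalPhenomena-5338 · support · rank 9 · closed · proved by Summit.CriticalPhenomena.PercolationContinuityZ3.Theorems.PercFoamCutQuadraticCutAssembly.quadraticCutAssembly_proof @ 9027a12a25f1 (prover) · by planner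
sources: BarskyGrimmettNewman1991, Grimmett1999, Zhang2000
[support] MacroCutQuadratic -> PercolationContinuityZ3 (the rate-free closing; provable now given
JumpFoamCheapCut): if theta(p_c) = theta* > 0, MacroCutQuadratic at p = p_c with a = theta*/250
gives c with P(cheap balanced cut) -> 0, while JumpFoamCheapCut with t = c n^2 gives probability >=
theta*^2/4 - 6(n+1)^2 h(n/4)/(c n^2) -> theta*^2/4 > 0, because h(r) -> 0 by BGN (continuity from
above: the intersection over r of the arm events is {C_H(0) infinite}, null by
BarskyGrimmettNewman1991_Z3_holds). Thresholds match: (theta*/2)|Λ_{n/4}| >= (theta*/250)|Λ_n| and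
(theta*/2)(|Λ_n| - |Λ_{n/2}|) >= (theta*/250)|Λ_n| for n large. [difficulty: provable-now] -/
@[route_item "route-CriticalPhenomena-PercFoamCut"]
def QuadraticCutAssembly : Prop :=
  (∀ p : unitInterval, 0 < Literature.Probability.Percolation.theta (Literature.Probability.LatticeModels.zdGraph 3) 0 p → ∀ a : ℝ, 0 < a → ∃ c : ℝ, 0 < c ∧ Filter.Tendsto (fun n : ℕ => (Literature.Probability.Percolation.bondPercolation (Literature.Probability.LatticeModels.zdGraph 3) p).real {ω | ∃ A : Finset (Literature.Probability.LatticeModels.Site 3), (∀ x ∈ A, x ∈ Literature.Probability.LatticeModels.box 3 n ∧ ω ∈ Literature.Probability.Percolation.percolatesAt x) ∧ a * (2 * (n : ℝ) + 1) ^ 3 ≤ (A.card : ℝ) ∧ a * (2 * (n : ℝ) + 1) ^ 3 ≤ (((Literature.Probability.LatticeModels.box 3 n).filter (fun x => ω ∈ Literature.Probability.Percolation.percolatesAt x ∧ x ∉ A)).card : ℝ) ∧ (((Literature.Probability.LatticeModels.edgeBoundary (Literature.Probability.LatticeModels.zdGraph 3) A).filter (fun e => e ∈ ω)).card : ℝ)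 ≤ c * (n : ℝ) ^ 2}) Filter.atTop (nhds 0)) → PercolationContinuityZ3

/-- item stmt-CriticalPhenomena-5339 · assembly · rank 1 · closed · proved by Summit.CriticalPhenomena.PercolationContinuityZ3.Theorems.PercFoamCutAssembly.assembly_proof @ 1922d85d9809 (prover) · by planner
sources: BarskyGrimmettNewman1991, Grimmett1999, arXiv:2207.05226
[assembly] MacroCutLog -> LogBGN -> PercolationContinuityZ3. Bookkeeping given the support
JumpFoamCheapCut: if theta(p_c) = theta* > 0, MacroCutLog at p = p_c with a = theta*/250 yields c
with P_{p_c}(balanced cut of cost <= c n^2/log n) -> 0; JumpFoamCheapCut with t = c n^2/log n yields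
probability >= theta*^2/4 - 6(2(n/2)+1)^2 h(n/4) log n/(c n^2) >= theta*^2/4 - (8/c) h(n/4) log n,
and h(n/4) log n <= 2 h(n/4) log(n/4) -> 0 for n >= 16 by LogBGN: contradiction. The cruxes
FiniteClusterVolumeTail (=> MacroCutLog by KGivesMacroCutLog), QuantitativeBGN (=> LogBGN) and
MacroCutQuadratic (=> conjunct by QuadraticCutAssembly) are the three engines feeding this one
chain. -/
@[route_item "route-CriticalPhenomena-PercFoamCut"]
def Assembly : Prop :=
  (∀ p : unitInterval, 0 < Literature.Probability.Percolation.theta (Literature.Probability.LatticeModels.zdGraph 3) 0 p → ∀ a : ℝ, 0 < a → ∃ c : ℝ, 0 < c ∧ Filter.Tendsto (fun n : ℕ => (Literature.Probability.Percolation.bondPercolation (Literature.Probability.LatticeModels.zdGraph 3) p).real {ω | ∃ A : Finset (Literature.Probability.LatticeModels.Site 3), (∀ x ∈ A, x ∈ Literature.Probability.LatticeModels.box 3 n ∧ ω ∈ Literature.Probability.Percolation.percolatesAt x) ∧ a * (2 * (n : ℝ) + 1) ^ 3 ≤ (A.card : ℝ) ∧ a * (2 * (n : ℝ) + 1) ^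 3 ≤ (((Literature.Probability.LatticeModels.box 3 n).filter (fun x => ω ∈ Literature.Probability.Percolation.percolatesAt x ∧ x ∉ A)).card : ℝ) ∧ (((Literature.Probability.LatticeModels.edgeBoundary (Literature.Probability.LatticeModels.zdGraph 3) A).filter (fun e => e ∈ ω)).card : ℝ) ≤ c * (n : ℝ) ^ 2 / Real.log (n : ℝ)}) Filter.atTop (nhds 0)) → (Filter.Tendsto (fun r : ℕ => Real.log (r : ℝ) * (Literature.Probability.Percolation.bondPercolation (Literature.Probability.LatticeModels.zdGraph 3) (Literature.Probability.Percolation.criticalProbI 3)).real {ω | ∃ y : Literature.Probability.LatticeModels.Site 3, (∃ i : Fin 3, ((r : ℕ) : ℤ) ≤ |y i|) ∧ ω ∈ Literature.Probability.Percolation.openConnIn {x : Literature.Probability.LatticeModels.Site 3 | 0 ≤ x 0} 0 y}) Filter.atTop (nhds 0)) → PercolationContinuityZ3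

/-! D-0027 §2.1 — DECIDING THEOREM (planner-authored via `route open/edit --closes-file`; by planner-rbadge-CriticalPhenomena-PercFoamCut-fe39b2ed-g4-0 2026-08-15T16:10:08Z):
its hypotheses are this route's items and its conclusion the sub-problem Statement (glue_lint), and it elaborates with this file. -/

@[closes "route-CriticalPhenomena-PercFoamCut"] theorem closes : MacroCutLog → LogBGN → Assembly → _root_.PercolationContinuityZ3 :=
  fun h_MacroCutLog h_LogBGN h_Assembly => h_Assembly h_MacroCutLog h_LogBGN

end Summit.CriticalPhenomena.PercolationContinuityZ3.Theses.PercFoamCut
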